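import Summits.HubbardSuperconductivity.HubbardSuperconductivity.Theses.LogColdTorus
import Literature.MathematicalPhysics.QuantumLattice.FinDimSpectrumGibbsLimitProofs
import Literature.MathematicalPhysics.QuantumLattice.HubbardWave0LiebProofs

/-!
# Route `LogColdTorus`, support `UniformDescent` (item `stmt-HubbardSuperconductivity-8809`)

GLUE for the uniform line of route `LogColdTorus`: if the (N_L, S^z = 0)-sector Gibbs state of the
pure torus Hubbard model carries d-wave pair order `c·L⁴ ≤ Re ω^{sec}_{β,L}(Δ_d†Δ_d)` for **all**
`β ≥ κ₀ log L` (not only at `β = κ log L`), then the tracial sector ground-state functional carries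
the same order: the compressed Hamiltonian `H.toBlock p p` is Hermitian, so its Gibbs state tends to
its ground-state functional as `β → ∞` (`Matrix.tendsto_gibbsState_atTop_holds`, the tree's proved
zero-temperature limit), and the closed inequality passes to the limit (`ge_of_tendsto`). The empty
sector is harmless (both functionals vanish on the zero observable algebra).

Sources: H. Tasaki, *Physics and Mathematics of Quantum Many-Body Systems* (2020), App. A;
O. Bratteli, D. W. Robinson, *Operator Algebras and Quantum Statistical Mechanics II*, §5.3.1.
-/

set_option linter.dupNamespace false

noncomputable section

namespace Summit.HubbardSuperconductivity.HubbardSuperconductivity.Theorems.LogColdTorus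

open Matrix Filter Topology Literature.MathematicalPhysics.QuantumLattice
open Summit.HubbardSuperconductivity.HubbardSuperconductivity.Theses.LogColdTorus

/-- Zero-temperature limit of the Gibbs state of a Hermitian matrix, without the `Nonempty`
hypothesis of `Matrix.tendsto_gibbsState_atTop_holds`: on an empty index type every observable is
`0` and both functionals vanish. Tasaki (2020) App. A. [cite: Tasaki2020, App. A] -/
theorem tendsto_gibbsState_atTop_of_isHermitian {n : Type*} [Fintype n] [DecidableEq n]
    {H : Matrix n n ℂ} (hH : H.IsHermitian) (A : Matrix n n ℂ) :
    Tendsto (fun β : ℝ => Matrix.gibbsState β H A) atTop (𝓝 (H.groundStateFunctional A)) := by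
  rcases isEmpty_or_nonempty n with hn | hn
  · have hA : A = 0 := Subsingleton.elim _ _
    simp only [hA, map_zero]
    exact tendsto_const_nhds
  · exact Matrix.tendsto_gibbsState_atTop_holds hH A

/-- Passage to the zero-temperature limit in a closed inequality: an eventual (in `β`) lower bound
on the real part of the Gibbs expectation of `A` is a lower bound on the real part of the tracial
ground-state expectation of `A`. Bratteli–Robinson II §5.3.1. [folklore] -/
theorem le_re_groundStateFunctional_of_forall_ge {n : Type*} [Fintype n] [DecidableEq n]
    {H : Matrix n n ℂ} (hH : H.IsHermitian) (A : Matrix n n ℂ) (b β₀ : ℝ)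
    (h : ∀ β : ℝ, β₀ ≤ β → b ≤ (Matrix.gibbsState β H A).re) :
    b ≤ (H.groundStateFunctional A).re := by
  have ht : Tendsto (fun β : ℝ => (Matrix.gibbsState β H A).re) atTop
      (𝓝 (H.groundStateFunctional A).re) :=
    (Complex.continuous_re.tendsto _).comp (tendsto_gibbsState_atTop_of_isHermitian hH A)
  exact ge_of_tendsto ht ((eventually_ge_atTop β₀).mono fun β hβ => h β hβ)

/-- **`UniformDescent` holds** (route `LogColdTorus`, support item `stmt-HubbardSuperconductivity-8809`):
sector Gibbs d-wave order `≥ c·L⁴` for all `β ≥ κ₀ log L` descends to the sector ground-state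
functional, by the zero-temperature limit of the Gibbs state of the (Hermitian) sector-compressed
torus Hubbard Hamiltonian. Tasaki (2020) App. A; Koma–Tasaki (1992). -/
theorem uniformDescent_proof : UniformDescent := by
  classical
  intro δ U₁ U₂ κ₀ c L₀ _hc h U hU L _ hL hev p
  have hH : (hubbardTorus 2 L 1 U).IsHermitian :=
    hubbardTorus_isHermitian (hamiltonian_isHermitian_and_commute_holds _) 1 U
  have hH' : ((hubbardTorus 2 L 1 U).toBlock p p).IsHermitian := hH.submatrix _
  exact le_re_groundStateFunctional_of_forall_ge hH' _ _ (κ₀ * Real.log L)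
    fun β hβ => h U hU L hL hev β hβ

end Summit.HubbardSuperconductivity.HubbardSuperconductivity.Theorems.LogColdTorus
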